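import Summits.QuantumFields.YangMills.Theorems.BalabanUVNodesN15KingModelThm33AtRegularField

/-!
# Route «BalabanUVNodes», node N15 = NE2 — THE KING-MODEL RUNG, PART Θ⁺-c: THE REGULAR-FIELD WINDOW OF PARTS Θ⁺∕Θ⁺-b IS GENUINELY CURVED —
# for every threshold it contains vector fields with NON-ZERO lattice field strength (a «tent» profile on one cycle of the torus)

Cell `pub-ymgap`, Track A (D-0062), seat `pub-ymgap-dag-n15-e` (R141 (C), s3 «King-model rung»), generation 21; companion of PART Θ⁺
(`…N15KingModelThm33AtRegularField`, p676497) and PART Θ⁺-b (`…N15KingModelB9Thm315AtRegularField`).  `bears_on: R4∕N15`;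
`--supports stmt-QuantumFields-27366` (K3⁸, `--as helper`).  COUNT-NEUTRAL.  Namespace `…N15KingModelRung.Curved`.

WHY.  PARTS Θ⁺∕Θ⁺-b state King's Theorem 3.3 ∕ [B9] Theorem 3.15 for EVERY vector field `A` on `T_ε` whose one-step differences `δ` satisfy the one
smallness `L^k·δ·|e| ≤ t` (King's Definition 3.2 (3.5) ∕ [Ba1] (2.23) ∕ [B9] (3.35) in r14's one-parameter currency), and exhibit `A = 0` in the window.
`A = 0` and the constant fields (flat connections) have zero field strength; this file shows the window is LIVE IN THE CURVED SENSE: for every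
`t > 0`, every charge and every level it contains a field whose lattice field strength `F_{μν}(x) = A_ν(x+εe_μ) − A_ν(x) − A_μ(x+εe_ν) + A_μ(x)`
([Ba1] (1.6) p. 604, King (2.7) p. 652 «F(p) = Σ_{b∈∂p} ε^{−1}A_b») does NOT vanish identically (`d ≥ 2`).

WHAT THIS FILE PROVES (0 `sorry`; two dictionary `def`s).
* §1 `tent n v = min(v, n − v)` on the cycle `ℤ∕n` (real-valued), `tent_step` (`|tent(v+1) − tent(v)| ≤ 1`, `n ≥ 2`, across the wrap too),
  `tent_one_sub_zero` (`tent 1 − tent 0 = 1`).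
* §2 `tentField c μ₀ ν₀ : HiggsLattice.VecField P 0` (`A_{ν₀}(x) = c·tent(x_{μ₀})`, other components `0`), `tentField_oneStep` (all one-step
  differences `≤ |c|`), `tentField_curl` (at the site with `x_{μ₀} = 0` the plaquette `(μ₀, ν₀)` has field strength `c`), ★ `exists_curved_in_window`:
  for `d ≥ 2`, every level `k` and every `t > 0` there are `A` and `δ ≥ 0` with one-step differences `≤ δ`, `L^k·δ·|e| ≤ t` AND a plaquette with
  non-zero field strength — so `thm33Printed_king_regularField` ∕ `thm315Printed_higgs_regularField` quantify over genuinely curved backgrounds.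
HONEST FRAMING.  Elementary lattice bookkeeping; no estimate; nothing of King's ∕ Bałaban's analysis; count-neutral; NE2⁺ NOT printed; N15 NOT discharged;
nothing continuum ∕ ℝ⁴ ∕ OS ∕ mass-gap ∕ Clay.
-/

noncomputable section

namespace Summit.QuantumFields.YangMills.BalabanUVNodes.N15KingModelRung.Curved

open Literature.MathematicalPhysics.QuantumFieldTheory.Balaban1983to89
open Literature.MathematicalPhysics.QuantumFieldTheory.Balaban1983to89.HiggsLattice (ChargeData)
open Literature.MathematicalPhysics.QuantumFieldTheory.Balaban1983to89.B1Ineq234BackgroundTorus (two_le_sitesPerDir)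

/-! ## §1 The tent profile on a cycle -/

/-- The TENT profile `min(v, n − v)` on the cycle `ℤ∕n` (real-valued). [folklore] -/
def tent (n : ℕ) (v : ZMod n) : ℝ := min (v.val : ℝ) ((n : ℝ) - v.val)

/-- The tent profile is `1`-Lipschitz along the cycle, across the wrap `n − 1 ↦ 0` too (`n ≥ 2`). [folklore] -/
theorem tent_step (n : ℕ) [NeZero n] (hn : 2 ≤ n) (v : ZMod n) : |tent n (v + 1) - tent n v| ≤ 1 := by
  unfold tent
  have hv : v.val < n := ZMod.val_lt v
  have hval : (v + 1).val = (v.val + 1) % n := by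
    rw [ZMod.val_add, ZMod.val_one_eq_one_mod, Nat.add_mod_mod]
  by_cases hlt : v.val + 1 < n
  · rw [Nat.mod_eq_of_lt hlt] at hval
    rw [hval]
    push_cast
    refine (abs_min_sub_min_le_max _ _ _ _).trans (max_le ?_ ?_)
    · rw [add_sub_cancel_left, abs_one]
    · rw [show ((n : ℝ) - ((v.val : ℝ) + 1)) - ((n : ℝ) - (v.val : ℝ)) = -1 by ring, abs_neg, abs_one]
  · have heq : v.val + 1 = n := by omega
    rw [heq, Nat.mod_self] at hval
    rw [hval]
    have hvr : (v.val : ℝ) = (n : ℝ) - 1 := by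
      have : ((v.val + 1 : ℕ) : ℝ) = (n : ℝ) := by exact_mod_cast heq
      push_cast at this; linarith
    rw [hvr]
    have hn' : (2 : ℝ) ≤ n := by exact_mod_cast hn
    rw [min_eq_left (by push_cast; linarith), min_eq_right (by linarith)]
    push_cast
    rw [show (0 : ℝ) - ((n : ℝ) - ((n : ℝ) - 1)) = -1 by ring, abs_neg, abs_one]

/-- `tent 1 − tent 0 = 1` (`n ≥ 2`): the profile has a genuine slope at the origin. [folklore] -/
theorem tent_one_sub_zero (n : ℕ) [NeZero n] (hn : 2 ≤ n) : tent n 1 - tent n 0 = 1 := by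
  unfold tent
  have hn' : (2 : ℝ) ≤ n := by exact_mod_cast hn
  rw [ZMod.val_one_eq_one_mod, Nat.mod_eq_of_lt (by omega : 1 < n), ZMod.val_zero]
  push_cast
  rw [min_eq_left (by linarith), sub_zero, min_eq_left (by linarith), sub_zero]

/-! ## §2 The tent field on `T_ε`: small one-step differences, non-zero field strength -/

variable {P : HiggsLattice.Params}

/-- THE TENT FIELD: `A_{ν₀}(x) = c·tent(x_{μ₀})`, all other components `0`. [cite: Balaban1982Higgs1, (1.4) p.604 «A : T*_ε → ℝ»] -/
def tentField (c : ℝ) (μ₀ ν₀ : Fin P.d) : HiggsLattice.VecField P 0 :=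
  fun b => if b.dir = ν₀ then c * tent (P.sitesPerDir 0 μ₀) (b.src μ₀) else 0

/-- All one-step differences of the tent field are `≤ |c|`. [cite: Balaban1982Higgs1, Prop. 2.1 (2.23) p.610] -/
theorem tentField_oneStep (c : ℝ) {μ₀ ν₀ : Fin P.d} :
    ∀ (z : HiggsLattice.Site P 0) (μ ν : Fin P.d), |tentField c μ₀ ν₀ ⟨z.shift ν, μ⟩ - tentField c μ₀ ν₀ ⟨z, μ⟩| ≤ |c| := by
  intro z μ ν
  unfold tentField
  by_cases hμ : μ = ν₀
  · simp only [hμ, if_true]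
    by_cases hν : ν = μ₀
    · subst hν
      have hs : (z.shift ν) ν = z ν + 1 := by simp [HiggsLattice.Site.shift]
      rw [hs, ← mul_sub, abs_mul]
      exact mul_le_of_le_one_right (abs_nonneg c) (tent_step _ (two_le_sitesPerDir P 0 ν) _)
    · have hs : (z.shift ν) μ₀ = z μ₀ := by
        simp [HiggsLattice.Site.shift, Function.update_of_ne (Ne.symm hν)]
      rw [hs, sub_self, abs_zero]; exact abs_nonneg c
  · simp only [hμ, if_false, sub_self, abs_zero]; exact abs_nonneg c

/-- THE TENT FIELD IS CURVED: at a site `x` with `x_{μ₀} = 0` the plaquette `(μ₀, ν₀)`, `μ₀ ≠ ν₀`, carries the field strength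
`A_{ν₀}(x + εe_{μ₀}) − A_{ν₀}(x) − A_{μ₀}(x + εe_{ν₀}) + A_{μ₀}(x) = c`. [cite: Balaban1982Higgs1, (1.6) p.604] [cite: King1986, (2.7) p.652] -/
theorem tentField_curl {μ₀ ν₀ : Fin P.d} (hμν : μ₀ ≠ ν₀) (c : ℝ) (x : HiggsLattice.Site P 0) (hx : x μ₀ = 0) :
    tentField c μ₀ ν₀ ⟨x.shift μ₀, ν₀⟩ - tentField c μ₀ ν₀ ⟨x, ν₀⟩
      - (tentField c μ₀ ν₀ ⟨x.shift ν₀, μ₀⟩ - tentField c μ₀ ν₀ ⟨x, μ₀⟩) = c := by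
  unfold tentField
  have h1 : (x.shift μ₀) μ₀ = 1 := by simp [HiggsLattice.Site.shift, hx]
  simp only [if_true, hμν, if_false, sub_self, sub_zero, h1, hx, ← mul_sub, tent_one_sub_zero _ (two_le_sitesPerDir P 0 μ₀),
    mul_one]

/-- ★ **THE WINDOW OF PARTS Θ⁺∕Θ⁺-b CONTAINS CURVED BACKGROUNDS**: for `d ≥ 2`, every level `k`, every charge and every threshold `t > 0` there are a
vector field `A` on `T_ε` and `δ ≥ 0` with all one-step differences `≤ δ`, the one smallness `L^k·δ·|e| ≤ t`, and a plaquette of non-zero field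
strength. [cite: King1986, Def. 3.2 (3.5) p.655, (2.7) p.652] [cite: Balaban1982Higgs1, Prop. 2.1 (2.23) p.610, (1.6) p.604] -/
theorem exists_curved_in_window {N : ℕ} (C : ChargeData N) (hd : 2 ≤ P.d) (k : ℕ) {t : ℝ} (ht : 0 < t) :
    ∃ (A : HiggsLattice.VecField P 0) (δ : ℝ), 0 ≤ δ ∧
      (∀ (z : HiggsLattice.Site P 0) (μ ν : Fin P.d), |A ⟨z.shift ν, μ⟩ - A ⟨z, μ⟩| ≤ δ) ∧
      (P.L : ℝ) ^ k * δ * |C.e| ≤ t ∧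
      ∃ (x : HiggsLattice.Site P 0) (μ ν : Fin P.d),
        A ⟨x.shift μ, ν⟩ - A ⟨x, ν⟩ - (A ⟨x.shift ν, μ⟩ - A ⟨x, μ⟩) ≠ 0 := by
  have hLk : (0 : ℝ) < (P.L : ℝ) ^ k := pow_pos (by exact_mod_cast P.hL) k
  -- the amplitude: `c = t ∕ (L^k (|e| + 1))`, so that `L^k·c·|e| ≤ t`
  set c : ℝ := t / ((P.L : ℝ) ^ k * (|C.e| + 1)) with hc
  have hcpos : 0 < c := by rw [hc]; positivity
  let μ₀ : Fin P.d := ⟨0, by omega⟩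
  let ν₀ : Fin P.d := ⟨1, by omega⟩
  have hμν : μ₀ ≠ ν₀ := by intro h; have := congrArg Fin.val h; simp [μ₀, ν₀] at this
  refine ⟨tentField c μ₀ ν₀, |c|, abs_nonneg c, tentField_oneStep c, ?_, (fun _ => 0), μ₀, ν₀, ?_⟩
  swap
  · rw [tentField_curl hμν c (fun _ => 0) rfl]; exact hcpos.ne'
  · rw [abs_of_pos hcpos, hc]
    have hden : 0 < (P.L : ℝ) ^ k * (|C.e| + 1) := by positivity
    calc (P.L : ℝ) ^ k * (t / ((P.L : ℝ) ^ k * (|C.e| + 1))) * |C.e|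
        = t * (|C.e| / (|C.e| + 1)) := by field_simp
      _ ≤ t * 1 := mul_le_mul_of_nonneg_left ((div_le_one (by positivity)).2 (by linarith [abs_nonneg C.e])) ht.le
      _ = t := mul_one t

end Summit.QuantumFields.YangMills.BalabanUVNodes.N15KingModelRung.Curved

end
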